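import Literature.Analysis.FluidPDE.AxisymHouLiVariables
import Literature.Analysis.FluidPDE.Wei2016RayTransfer
import Mathlib.Analysis.Calculus.LineDeriv.IntegrationByParts
import HarnessLib

/-!
# Lei–Zhang 2017, Lemma 2.1 (Hou–Lei–Li): `‖∇(u^r/r)‖₂ ≤ ‖ω^θ/r‖₂`, `‖Δ(u^r/r)‖₂ ≤ ‖∂_z(ω^θ/r)‖₂`

Analysis/FluidPDE proof file (all results proved; no definitions, no named facts) on the
decomposition path of the named fact
`Literature.Analysis.FluidPDE.LeiZhang2017_smallSwirl_regularity` (Z. Lei, Q. S. Zhang,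
Pacific J. Math. 289 (2017) = arXiv:1505.02628, Thm. 1.4), formalising its key elliptic input

> **Lemma 2.1.** Let `v^r` be the radial component of the velocity field and `Ω = ω^θ/r`. Then
> there exists an absolute positive constant `K₀ > 0` such that
> `‖∇(v^r/r)‖_{L²} ≤ K₀ ‖Ω‖_{L²}`, `‖∇²(v^r/r)‖_{L²} ≤ K₀ ‖∂_z Ω‖_{L²}`

(originally Hou–Lei–Li 2008 in the periodic case, Lei 2015 (4.5)–(4.6) in general; "one may also
use the magic formula given by Miao and Zheng"). It is derived here, with `K₀ = 1` and in the
form needed for Agmon's inequality (`‖Δ(v^r/r)‖₂` in place of `‖∇²(v^r/r)‖₂`), from the pointwise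
identity `Δρ + 2 q_ρ = ∂_z ω₁` of `AxisymHouLiVariables` (`ρ = u^r/r = radVelQuot u`,
`ω₁ = ω^θ/r = angVortQuot u`, `q_F = radDerivQuot F = (∂ᵣF)/r`) by two integrations by parts
on the whole space, the only non-trivial ingredient being the sign of the axis term:

* `laplacianH_eq_two_mul_radDerivQuot_add` — for an axisymmetric scalar `G ∈ C³`,
  `∂₀∂₀G + ∂₁∂₁G = 2 q_G + (x₀∂₀q_G + x₁∂₁q_G)` everywhere (differentiate `xᵢ q_G = ∂ᵢG`);
* `fderiv_radDerivQuot_single_two` — `∂₂ q_G = q_{∂₂G}`;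
* `IsAxisymmetricScalar.integral_mul_radDerivQuot_nonpos` — **the axis term has a sign**:
  `∫ H q_H dx = −(c₂/2) ∫ H(0,0,z)² dz ≤ 0` for an axisymmetric `H ∈ C²` with `H, q_H ∈ L²`
  (cylindrical Fubini `IsAxisymmetricScalar.integral_eq`, rays integrable for a.e. `z` by
  `Wei2016.ae_integrableOn_profile`, and on each ray
  `ρ H q_H = H ∂_ρH = ½ ∂_ρ(H²)`, whose integral over `(0, ∞)` is `−½ H(0,0,z)²`);
* `integral_laplacianH_mul_radDerivQuot` — `∫ (∂₀∂₀G + ∂₁∂₁G) q_G = ∫ q_G²`;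
* `integral_fderiv_fderiv_two_mul_radDerivQuot_nonneg` — `0 ≤ ∫ ∂₂∂₂G · q_G`;
* `integral_laplacian_sq_le` — hence `∫ (ΔG)² ≤ ∫ (ΔG + 2q_G)²`, and with `G = ρ`,
  **`∫ (Δρ)² ≤ ∫ (∂_zω₁)²`** (`integral_laplacian_radVelQuot_sq_le`);
* `integral_gradSq_radVelQuot_le` — **`∫ |∇ρ|² ≤ ∫ ω₁²`** (pair the identity with `ρ`:
  `∫|∇ρ|² − 2∫ρ q_ρ = ∫ ω₁ ∂_zρ ≤ ½∫ω₁² + ½∫|∇ρ|²` and `∫ ρ q_ρ ≤ 0`).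

All integrals are over `ℝ³`; the standing hypotheses are smoothness (`u ∈ C⁵`, so that
`ρ ∈ C³`, `ω₁ ∈ C²`), axisymmetry, `div u = 0`, and square integrability of the finitely many
functions that are paired (`ρ`, `∂ᵢρ`, `∂ᵢ∂ᵢρ`, `q_ρ`, `∂₂q_ρ`, `ω₁`, `∂₂ω₁`), which hold for
the smooth finite-energy solutions to which the lemma is applied (sibling file). Whole-space
integration by parts is Mathlib's `integral_mul_fderiv_eq_neg_fderiv_mul_of_integrable`
(integrable data, no decay at infinity needed).

## Mathlib / tree search

Tree: `AxisymHouLiVariables` (the identity, the variables), `AxisymRadialQuotient`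
(`radDerivQuot` API), `CylindricalIntegration` (`IsAxisymmetricScalar.integral_eq`,
`hasDerivAt_meridianPoint_fst`), `Wei2016RayTransfer` (`Wei2016.ae_integrableOn_profile`, the
a.e. integrability of rays), `NSStrongSpeedBound`
(`abs_le_agmon_two_param`, used downstream). Mathlib:
`integral_mul_fderiv_eq_neg_fderiv_mul_of_integrable`,
`integral_Ioi_of_hasDerivAt_of_tendsto'`, `tendsto_zero_of_hasDerivAt_of_integrableOn_Ioi`,
`lean search 'HouLeiLi|radVelQuot.*le'`:
nothing before this file.

## References

* Z. Lei, Q. S. Zhang, Pacific J. Math. 289 (2017) = arXiv:1505.02628, Lemma 2.1 (p. 6 of the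
  arXiv version) and its use in §4. [LeiZhang2017]
* T. Y. Hou, Z. Lei, C. Li, Comm. PDE 33 (2008) 1622–1637; Z. Lei, J. Differential Equations 259
  (2015) 3202–3215 = arXiv:1212.5968, (4.5)–(4.6); C. Miao, X. Zheng, Comm. Math. Phys. 321
  (2013), the "magic formula".
-/

noncomputable section

open MeasureTheory Set Function Filter Topology
open scoped ContDiff Laplacian ENNReal

namespace Literature.Analysis.FluidPDE

/-! ### The horizontal Laplacian of an axisymmetric scalar through `q = (∂ᵣG)/r` -/

section Horizontal

variable {G : EuclideanSpace ℝ (Fin 3) → ℝ}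

/-- Mixed second directional derivatives of a `C²` scalar commute: `∂_b∂_a G = ∂_a∂_b G`.
[folklore] -/
theorem fderiv_fderiv_apply_comm_vec_scalar (hG : ContDiff ℝ 2 G)
    (x a b : EuclideanSpace ℝ (Fin 3)) :
    fderiv ℝ (fun y => fderiv ℝ G y a) x b = fderiv ℝ (fun y => fderiv ℝ G y b) x a := by
  have hd : DifferentiableAt ℝ (fderiv ℝ G) x :=
    ((hG.fderiv_right (m := 1) (by norm_num)).differentiable one_ne_zero) x
  rw [fderiv_clm_apply hd (differentiableAt_const a),
    fderiv_clm_apply hd (differentiableAt_const b)]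
  simp only [fderiv_fun_const, Pi.zero_apply, ContinuousLinearMap.comp_zero, zero_add,
    ContinuousLinearMap.flip_apply]
  exact (hG.contDiffAt.isSymmSndFDerivAt (by simp)) b a

/-- Differentiating `xᵢ · q_G = ∂ᵢG` along `eᵢ`: `q_G + xᵢ ∂ᵢq_G = ∂ᵢ∂ᵢG` (`i = 0, 1`), for an
axisymmetric scalar `G ∈ C³`. [folklore] -/
theorem radDerivQuot_add_mul_fderiv_eq (hG : ContDiff ℝ 3 G) (hax : IsAxisymmetricScalar G)
    {i : Fin 3} (hi : i = 0 ∨ i = 1) (x : EuclideanSpace ℝ (Fin 3)) :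
    radDerivQuot G x + x i * fderiv ℝ (radDerivQuot G) x (EuclideanSpace.single i 1) =
      fderiv ℝ (fun y => fderiv ℝ G y (EuclideanSpace.single i 1)) x
        (EuclideanSpace.single i 1) := by
  have hG2 : ContDiff ℝ 2 G := hG.of_le (by norm_num)
  have hq1 : ContDiff ℝ 1 (radDerivQuot G) := contDiff_radDerivQuot (n := 1) (by exact_mod_cast hG)
  have hqd : DifferentiableAt ℝ (radDerivQuot G) x := (hq1.differentiable one_ne_zero) x
  -- the global identity `xᵢ q = ∂ᵢG`
  have hfun : ((fun y : EuclideanSpace ℝ (Fin 3) => y i) * radDerivQuot G) =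
      fun y => fderiv ℝ G y (EuclideanSpace.single i 1) := funext fun y => by
    rw [Pi.mul_apply]
    rcases hi with h | h <;> subst h
    · exact mul_radDerivQuot_eq_fderiv_zero hG2 hax y
    · exact mul_radDerivQuot_eq_fderiv_one hG2 hax y
  have hcoord : HasFDerivAt (fun y : EuclideanSpace ℝ (Fin 3) => y i)
      (EuclideanSpace.proj (𝕜 := ℝ) i) x := (EuclideanSpace.proj (𝕜 := ℝ) i).hasFDerivAt
  have hprod := hcoord.mul hqd.hasFDerivAt
  rw [hfun] at hprod
  have h := congrArg (fun T : EuclideanSpace ℝ (Fin 3) →L[ℝ] ℝ => T (EuclideanSpace.single i 1))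
    hprod.fderiv
  have hproj : (EuclideanSpace.proj (𝕜 := ℝ) i) (EuclideanSpace.single i (1 : ℝ)) = 1 := by
    simp
  simp only [_root_.add_apply, _root_.smul_apply, smul_eq_mul, hproj] at h
  rw [h]
  ring

/-- **The horizontal Laplacian through the radial derivative quotient**: for an axisymmetric
scalar `G ∈ C³`, everywhere on `ℝ³`,
`∂₀∂₀G + ∂₁∂₁G = 2 q_G + (x₀∂₀q_G + x₁∂₁q_G)`, i.e. `∂ᵣ²G + (1/r)∂ᵣG = 2q + r∂ᵣq` with
`q = (∂ᵣG)/r`. [folklore] -/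
theorem laplacianH_eq_two_mul_radDerivQuot_add (hG : ContDiff ℝ 3 G) (hax : IsAxisymmetricScalar G)
    (x : EuclideanSpace ℝ (Fin 3)) :
    fderiv ℝ (fun y => fderiv ℝ G y (EuclideanSpace.single 0 1)) x (EuclideanSpace.single 0 1) +
      fderiv ℝ (fun y => fderiv ℝ G y (EuclideanSpace.single 1 1)) x (EuclideanSpace.single 1 1) =
      2 * radDerivQuot G x + (x 0 * fderiv ℝ (radDerivQuot G) x (EuclideanSpace.single 0 1) +
        x 1 * fderiv ℝ (radDerivQuot G) x (EuclideanSpace.single 1 1)) := by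
  rw [← radDerivQuot_add_mul_fderiv_eq hG hax (Or.inl rfl) x,
    ← radDerivQuot_add_mul_fderiv_eq hG hax (Or.inr rfl) x]
  ring

/-- **`∂₂ q_G = q_{∂₂G}`**: the radial derivative quotient commutes with the axial derivative, for
an axisymmetric scalar `G ∈ C³` (multiply both sides by `x₀`: `∂₂∂₀G = ∂₀∂₂G`; density).
[folklore] -/
theorem fderiv_radDerivQuot_single_two (hG : ContDiff ℝ 3 G) (hax : IsAxisymmetricScalar G)
    (x : EuclideanSpace ℝ (Fin 3)) :
    fderiv ℝ (radDerivQuot G) x (EuclideanSpace.single 2 1) =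
      radDerivQuot (fun y => fderiv ℝ G y (EuclideanSpace.single 2 1)) x := by
  have hG2 : ContDiff ℝ 2 G := hG.of_le (by norm_num)
  have hGd : Differentiable ℝ G := hG.differentiable (by norm_num)
  have hq1 : ContDiff ℝ 1 (radDerivQuot G) := contDiff_radDerivQuot (n := 1) (by exact_mod_cast hG)
  set H : EuclideanSpace ℝ (Fin 3) → ℝ := fun y => fderiv ℝ G y (EuclideanSpace.single 2 1) with hH
  have hH2 : ContDiff ℝ 2 H := contDiff_fderiv_apply_const_succ (n := 2) (by exact_mod_cast hG) _
  have hHax : IsAxisymmetricScalar H := hax.fderiv_apply_single_two hGd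
  have hc1 : Continuous fun y => fderiv ℝ (radDerivQuot G) y (EuclideanSpace.single 2 1) :=
    (contDiff_fderiv_apply_const_succ (n := 0) (by exact_mod_cast hq1) _).continuous
  have hc2 : Continuous (radDerivQuot H) := continuous_radDerivQuot hH2
  refine eq_of_eq_off_ker (EuclideanSpace.proj (0 : Fin 3)) ⟨EuclideanSpace.single 0 1, by simp⟩
    hc1 hc2 (fun z hz => ?_) x
  have hz0 : z 0 ≠ 0 := by simpa using hz
  apply mul_left_cancel₀ hz0
  -- `x₀ ∂₂q = ∂₂(x₀ q) = ∂₂∂₀G` and `x₀ q_H = ∂₀H = ∂₀∂₂G`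
  rw [mul_radDerivQuot_eq_fderiv_zero hH2 hHax z, hH,
    fderiv_fderiv_apply_comm_vec_scalar hG2 z (EuclideanSpace.single 2 1)
      (EuclideanSpace.single 0 1)]
  -- `∂₂ (x₀ q) = x₀ ∂₂ q`
  have hfun : (fun y : EuclideanSpace ℝ (Fin 3) => fderiv ℝ G y (EuclideanSpace.single 0 1)) =
      ((fun y : EuclideanSpace ℝ (Fin 3) => y 0) * radDerivQuot G) := funext fun y => by
    rw [Pi.mul_apply]; exact (mul_radDerivQuot_eq_fderiv_zero hG2 hax y).symm
  rw [hfun]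
  have hqd : DifferentiableAt ℝ (radDerivQuot G) z := (hq1.differentiable one_ne_zero) z
  have hcoord : HasFDerivAt (fun y : EuclideanSpace ℝ (Fin 3) => y 0)
      (EuclideanSpace.proj (𝕜 := ℝ) 0) z := (EuclideanSpace.proj (𝕜 := ℝ) 0).hasFDerivAt
  rw [(hcoord.mul hqd.hasFDerivAt).fderiv]
  simp

end Horizontal


/-! ### The axis term has a sign -/

section Axis

/-- The product of two axisymmetric scalars is an axisymmetric scalar. [folklore] -/
theorem IsAxisymmetricScalar.mul {f g : EuclideanSpace ℝ (Fin 3) → ℝ} (hf : IsAxisymmetricScalar f)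
    (hg : IsAxisymmetricScalar g) : IsAxisymmetricScalar fun x => f x * g x := fun θ x => by
  simp only [hf θ x, hg θ x]

/-- **On a ray, `∫₀^∞ H ∂_ρH dρ = −½ H(0)² ≤ 0`.** For `H ∈ C¹` along the ray `ρ ↦ (ρ, 0, z)`
with `ρ ↦ H ∂₀H` and `ρ ↦ ρ H²` integrable on `(0, ∞)`: `½H²` has the integrable derivative
`H ∂₀H`, is integrable on `(1, ∞)` (dominated by `½ ρ H²`), hence tends to `0`, and the
fundamental theorem of calculus on `(0, ∞)` applies. [folklore] -/
theorem integral_Ioi_mul_fderiv_ray_nonpos {H : EuclideanSpace ℝ (Fin 3) → ℝ}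
    (hHd : Differentiable ℝ H) (z : ℝ)
    (h1 : IntegrableOn (fun ρ : ℝ => H (meridianPoint (ρ, z)) *
      fderiv ℝ H (meridianPoint (ρ, z)) (EuclideanSpace.single 0 1)) (Ioi 0))
    (h2 : IntegrableOn (fun ρ : ℝ => ρ * H (meridianPoint (ρ, z)) ^ 2) (Ioi 0)) :
    ∫ ρ in Ioi (0 : ℝ), H (meridianPoint (ρ, z)) *
      fderiv ℝ H (meridianPoint (ρ, z)) (EuclideanSpace.single 0 1) =
      -(1 / 2 * H (meridianPoint (0, z)) ^ 2) := by
  set φ : ℝ → ℝ := fun ρ => 1 / 2 * H (meridianPoint (ρ, z)) ^ 2 with hφ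
  set φ' : ℝ → ℝ := fun ρ => H (meridianPoint (ρ, z)) *
    fderiv ℝ H (meridianPoint (ρ, z)) (EuclideanSpace.single 0 1) with hφ'
  have hline : ∀ ρ, HasDerivAt (fun ρ : ℝ => H (meridianPoint (ρ, z)))
      (fderiv ℝ H (meridianPoint (ρ, z)) (EuclideanSpace.single 0 1)) ρ := fun ρ =>
    (hHd _).hasFDerivAt.comp_hasDerivAt ρ (hasDerivAt_meridianPoint_fst ρ z)
  have hderiv : ∀ ρ, HasDerivAt φ (φ' ρ) ρ := by
    intro ρ
    have h := ((hline ρ).pow 2).const_mul (1 / 2 : ℝ)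
    refine h.congr_deriv ?_
    simp only [hφ']
    ring
  have hcontH : Continuous fun ρ : ℝ => H (meridianPoint (ρ, z)) :=
    continuous_iff_continuousAt.2 fun ρ => (hline ρ).continuousAt
  -- `φ` is integrable on `(1, ∞)`
  have hφint : IntegrableOn φ (Ioi 1) := by
    have hdom : IntegrableOn (fun ρ : ℝ => 1 / 2 * (ρ * H (meridianPoint (ρ, z)) ^ 2)) (Ioi 1) :=
      (h2.mono_set (Ioi_subset_Ioi zero_le_one)).const_mul _
    refine hdom.mono' ((continuous_const.mul (hcontH.pow 2)).aestronglyMeasurable) ?_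
    refine (ae_restrict_iff' measurableSet_Ioi).2 (Eventually.of_forall fun ρ (hρ : 1 < ρ) => ?_)
    have hsq : 0 ≤ H (meridianPoint (ρ, z)) ^ 2 := sq_nonneg _
    simp only [hφ]
    rw [Real.norm_eq_abs, abs_of_nonneg (by positivity)]
    nlinarith
  have htend : Tendsto φ atTop (𝓝 0) :=
    tendsto_zero_of_hasDerivAt_of_integrableOn_Ioi (a := 1) (fun ρ _ => hderiv ρ)
      (h1.mono_set (Ioi_subset_Ioi zero_le_one)) hφint
  have hFTC := integral_Ioi_of_hasDerivAt_of_tendsto' (a := 0) (fun ρ _ => hderiv ρ) h1 htend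
  rw [hFTC, zero_sub]

variable {H : EuclideanSpace ℝ (Fin 3) → ℝ}

/-- **The axis term has a sign.** For an axisymmetric scalar `H ∈ C²` with `H, q_H ∈ L²`
(`q_H = radDerivQuot H = (∂ᵣH)/r`):
`∫ H q_H dx = ∫ (x_h·∇H) H / r² dx = −(c₂/2) ∫ H(0,0,z)² dz ≤ 0`.
Proof: `H q_H` is an integrable axisymmetric scalar, so by cylindrical Fubini
(`IsAxisymmetricScalar.integral_eq`) `∫ H q_H = ∫ dz c₂ ∫₀^∞ ρ H q_H (ρ,0,z) dρ`, and on each ray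
`ρ q_H = ∂₀H` (`mul_radDerivQuot_eq_fderiv_zero`), so the inner integral is
`∫₀^∞ H∂_ρH = −½H(0,0,z)² ≤ 0` (`integral_Ioi_mul_fderiv_ray_nonpos`, the rays being integrable
for a.e. `z`). This is the boundary term at `r = 0` of Lei–Zhang's energy identities ("`∫ J(Δ +
(2/r)∂ᵣ)J = −‖∇J‖² − ∫|J(t,0,z)|²dz`", §3). [cite: LeiZhang2017, §3 (axis boundary terms, p. 8)] -/
theorem IsAxisymmetricScalar.integral_mul_radDerivQuot_nonpos (hax : IsAxisymmetricScalar H)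
    (hH : ContDiff ℝ 2 H) (hL2 : MemLp H 2 volume) (hq : MemLp (radDerivQuot H) 2 volume) :
    ∫ x, H x * radDerivQuot H x ≤ 0 := by
  have hHd : Differentiable ℝ H := hH.differentiable two_ne_zero
  have hfax : IsAxisymmetricScalar fun x => H x * radDerivQuot H x :=
    hax.mul (isAxisymmetricScalar_radDerivQuot hH hax)
  have hfi : Integrable fun x => H x * radDerivQuot H x := hL2.integrable_mul hq
  have hsqax : IsAxisymmetricScalar fun x => H x ^ 2 := fun θ x => by simp only [hax θ x]
  have hsqi : Integrable fun x => H x ^ 2 := hL2.integrable_sq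
  rw [hfax.integral_eq hfi]
  apply integral_nonpos_of_ae
  filter_upwards [Wei2016.ae_integrableOn_profile hfax hfi,
    Wei2016.ae_integrableOn_profile hsqax hsqi] with z hfz hHz
  -- on the ray: `ρ (H q_H)(ρ,0,z) = H ∂₀H (ρ,0,z)`
  have heq : EqOn
      (fun ρ : ℝ => ρ * (H (meridianPoint (ρ, z)) * radDerivQuot H (meridianPoint (ρ, z))))
      (fun ρ : ℝ => H (meridianPoint (ρ, z)) *
        fderiv ℝ H (meridianPoint (ρ, z)) (EuclideanSpace.single 0 1)) (Ioi 0) := by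
    intro ρ _
    have h := mul_radDerivQuot_eq_fderiv_zero hH hax (meridianPoint (ρ, z))
    rw [meridianPoint_apply_zero] at h
    simp only
    rw [← h]
    ring
  have h1 : IntegrableOn (fun ρ : ℝ => H (meridianPoint (ρ, z)) *
      fderiv ℝ H (meridianPoint (ρ, z)) (EuclideanSpace.single 0 1)) (Ioi 0) :=
    hfz.congr_fun heq measurableSet_Ioi
  have hray := integral_Ioi_mul_fderiv_ray_nonpos hHd z h1 hHz
  have hint : ∫ ρ in Ioi (0 : ℝ), ρ • (H (meridianPoint (ρ, z)) *
      radDerivQuot H (meridianPoint (ρ, z))) ≤ 0 := by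
    simp only [smul_eq_mul]
    rw [setIntegral_congr_fun measurableSet_Ioi heq, hray]
    have : 0 ≤ H (meridianPoint (0, z)) ^ 2 := sq_nonneg _
    linarith
  rw [smul_eq_mul]
  exact mul_nonpos_of_nonneg_of_nonpos radialConst₂_pos.le hint

end Axis


/-! ### Integration by parts on the whole space (integrable data) -/

section IBP

/-- Whole-space integration by parts for everywhere differentiable functions with the three
products integrable (Mathlib's `integral_mul_fderiv_eq_neg_fderiv_mul_of_integrable`). [folklore] -/
theorem integral_mul_fderiv_eq_neg_of_differentiable {f g : EuclideanSpace ℝ (Fin 3) → ℝ}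
    (hf : Differentiable ℝ f) (hg : Differentiable ℝ g) (v : EuclideanSpace ℝ (Fin 3))
    (h1 : Integrable fun x => fderiv ℝ f x v * g x)
    (h2 : Integrable fun x => f x * fderiv ℝ g x v) (h3 : Integrable fun x => f x * g x) :
    ∫ x, f x * fderiv ℝ g x v = -∫ x, fderiv ℝ f x v * g x :=
  integral_mul_fderiv_eq_neg_fderiv_mul_of_integrable h1 h2 h3 (fun x _ => hf x) fun x _ => hg x

/-- `∫ f ∂ᵥ∂ᵥf = −∫ (∂ᵥf)²` for `f ∈ C²` with `f, ∂ᵥf, ∂ᵥ∂ᵥf ∈ L²`. [folklore] -/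
theorem integral_mul_fderiv_fderiv_eq_neg_sq {f : EuclideanSpace ℝ (Fin 3) → ℝ}
    (hf : ContDiff ℝ 2 f)
    (v : EuclideanSpace ℝ (Fin 3)) (h0 : MemLp f 2 volume)
    (h1 : MemLp (fun x => fderiv ℝ f x v) 2 volume)
    (h2 : MemLp (fun x => fderiv ℝ (fun y => fderiv ℝ f y v) x v) 2 volume) :
    ∫ x, f x * fderiv ℝ (fun y => fderiv ℝ f y v) x v = -∫ x, fderiv ℝ f x v ^ 2 := by
  have hfd : Differentiable ℝ f := hf.differentiable two_ne_zero
  have hgd : Differentiable ℝ fun y => fderiv ℝ f y v :=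
    (contDiff_fderiv_apply_const_succ (n := 1) (by exact_mod_cast hf) v).differentiable one_ne_zero
  rw [integral_mul_fderiv_eq_neg_of_differentiable hfd hgd v (h1.integrable_mul h1)
    (h0.integrable_mul h2) (h0.integrable_mul h1)]
  congr 1
  refine integral_congr_ae (Eventually.of_forall fun x => ?_)
  simp only
  ring

end IBP

/-! ### The two integrated identities for an axisymmetric scalar `G` -/

section Integrated

variable {G : EuclideanSpace ℝ (Fin 3) → ℝ}

/-- `∫ xᵢ q ∂ᵢq = −½ ∫ q²` (`i = 0, 1`; `q = q_G`), by parts: `∂ᵢ(xᵢ q) = q + xᵢ∂ᵢq` and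
`xᵢ q = ∂ᵢG`. [folklore] -/
theorem integral_coord_mul_radDerivQuot_mul_fderiv (hG : ContDiff ℝ 3 G)
    (hax : IsAxisymmetricScalar G)
    {i : Fin 3} (hi : i = 0 ∨ i = 1) (hq : MemLp (radDerivQuot G) 2 volume)
    (hGi : MemLp (fun x => fderiv ℝ G x (EuclideanSpace.single i 1)) 2 volume)
    (hxq : MemLp (fun x => x i * fderiv ℝ (radDerivQuot G) x (EuclideanSpace.single i 1)) 2
      volume) :
    ∫ x, x i * radDerivQuot G x * fderiv ℝ (radDerivQuot G) x (EuclideanSpace.single i 1) =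
      -(1 / 2) * ∫ x, radDerivQuot G x ^ 2 := by
  have hG2 : ContDiff ℝ 2 G := hG.of_le (by norm_num)
  have hq1 : ContDiff ℝ 1 (radDerivQuot G) := contDiff_radDerivQuot (n := 1) (by exact_mod_cast hG)
  have hqd : Differentiable ℝ (radDerivQuot G) := hq1.differentiable one_ne_zero
  -- `f = xᵢ q = ∂ᵢG`, `g = q`
  set f : EuclideanSpace ℝ (Fin 3) → ℝ := fun x => x i * radDerivQuot G x with hf
  have hfeq : f = fun x => fderiv ℝ G x (EuclideanSpace.single i 1) := funext fun y => by
    rcases hi with h | h <;> subst h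
    · exact mul_radDerivQuot_eq_fderiv_zero hG2 hax y
    · exact mul_radDerivQuot_eq_fderiv_one hG2 hax y
  have hfd : Differentiable ℝ f := fun x =>
    ((EuclideanSpace.proj (𝕜 := ℝ) i).differentiableAt).mul (hqd x)
  have hf' : ∀ x, fderiv ℝ f x (EuclideanSpace.single i 1) =
      radDerivQuot G x + x i * fderiv ℝ (radDerivQuot G) x (EuclideanSpace.single i 1) := by
    intro x
    have hcoord : HasFDerivAt (fun y : EuclideanSpace ℝ (Fin 3) => y i)
        (EuclideanSpace.proj (𝕜 := ℝ) i) x := (EuclideanSpace.proj (𝕜 := ℝ) i).hasFDerivAt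
    have hprod := hcoord.mul (hqd x).hasFDerivAt
    have hproj : (EuclideanSpace.proj (𝕜 := ℝ) i) (EuclideanSpace.single i (1 : ℝ)) = 1 := by simp
    have h := congrArg (fun T : EuclideanSpace ℝ (Fin 3) →L[ℝ] ℝ => T (EuclideanSpace.single i 1))
      hprod.fderiv
    simp only [_root_.add_apply, _root_.smul_apply, smul_eq_mul, hproj] at h
    rw [show f = ((fun y : EuclideanSpace ℝ (Fin 3) => y i) * radDerivQuot G) from rfl, h]
    ring
  have hfL2 : MemLp f 2 volume := by rw [hfeq]; exact hGi
  -- the three products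
  have hI1 : Integrable fun x => fderiv ℝ f x (EuclideanSpace.single i 1) * radDerivQuot G x := by
    have h := (hq.integrable_mul hq).add (hxq.integrable_mul hq)
    refine h.congr (Eventually.of_forall fun x => ?_)
    simp only [Pi.add_apply, Pi.mul_apply, hf']
    ring
  have hI2 : Integrable fun x => f x * fderiv ℝ (radDerivQuot G) x (EuclideanSpace.single i 1) := by
    have h := hq.integrable_mul hxq
    refine h.congr (Eventually.of_forall fun x => ?_)
    simp only [Pi.mul_apply, hf]
    ring
  have hI3 : Integrable fun x => f x * radDerivQuot G x := hfL2.integrable_mul hq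
  have hibp := integral_mul_fderiv_eq_neg_of_differentiable hfd hqd (EuclideanSpace.single i 1)
    hI1 hI2 hI3
  -- `∫ f ∂ᵢq = −∫ (q + xᵢ∂ᵢq) q = −∫ q² − ∫ f ∂ᵢq`
  have hsplit : ∫ x, fderiv ℝ f x (EuclideanSpace.single i 1) * radDerivQuot G x =
      (∫ x, radDerivQuot G x ^ 2) + ∫ x, f x * fderiv ℝ (radDerivQuot G) x
        (EuclideanSpace.single i 1) := by
    rw [← integral_add hq.integrable_sq hI2]
    refine integral_congr_ae (Eventually.of_forall fun x => ?_)
    show fderiv ℝ f x (EuclideanSpace.single i 1) * radDerivQuot G x =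
      radDerivQuot G x ^ 2 + f x * fderiv ℝ (radDerivQuot G) x (EuclideanSpace.single i 1)
    rw [hf']
    simp only [hf]
    ring
  rw [hsplit] at hibp
  have hmain : ∫ x, f x * fderiv ℝ (radDerivQuot G) x (EuclideanSpace.single i 1) =
      -(1 / 2) * ∫ x, radDerivQuot G x ^ 2 := by linarith
  simpa only [hf] using hmain

/-- **`∫ (∂₀∂₀G + ∂₁∂₁G) q_G = ∫ q_G²`** for an axisymmetric scalar `G ∈ C³` with
`q_G, ∂₀G, ∂₁G, x₀∂₀q_G, x₁∂₁q_G ∈ L²`: pointwise `Δ_hG = 2q + x_h·∇q`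
(`laplacianH_eq_two_mul_radDerivQuot_add`) and `∫ xᵢ q ∂ᵢq = −½∫q²`. This is the planar identity
`∫ (g_rr + g_r/r)(g_r/r) r dr = ∫ g_r²/r dr` (the boundary term `½[g_r²]` vanishes since
`g_r(0) = 0` for axisymmetric `g`). [folklore] -/
theorem integral_laplacianH_mul_radDerivQuot (hG : ContDiff ℝ 3 G) (hax : IsAxisymmetricScalar G)
    (hq : MemLp (radDerivQuot G) 2 volume)
    (hG0 : MemLp (fun x => fderiv ℝ G x (EuclideanSpace.single 0 1)) 2 volume)
    (hG1 : MemLp (fun x => fderiv ℝ G x (EuclideanSpace.single 1 1)) 2 volume)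
    (hxq0 : MemLp (fun x => x 0 * fderiv ℝ (radDerivQuot G) x (EuclideanSpace.single 0 1)) 2
      volume)
    (hxq1 : MemLp (fun x => x 1 * fderiv ℝ (radDerivQuot G) x (EuclideanSpace.single 1 1)) 2
      volume) :
    ∫ x, (fderiv ℝ (fun y => fderiv ℝ G y (EuclideanSpace.single 0 1)) x
      (EuclideanSpace.single 0 1) +
        fderiv ℝ (fun y => fderiv ℝ G y (EuclideanSpace.single 1 1)) x
          (EuclideanSpace.single 1 1)) *
      radDerivQuot G x = ∫ x, radDerivQuot G x ^ 2 := by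
  have h0 := integral_coord_mul_radDerivQuot_mul_fderiv hG hax (Or.inl rfl) hq hG0 hxq0
  have h1 := integral_coord_mul_radDerivQuot_mul_fderiv hG hax (Or.inr rfl) hq hG1 hxq1
  have hIa : Integrable fun x => x 0 * radDerivQuot G x *
      fderiv ℝ (radDerivQuot G) x (EuclideanSpace.single 0 1) := by
    have h := hq.integrable_mul hxq0
    exact h.congr (Eventually.of_forall fun x => by simp only [Pi.mul_apply]; ring)
  have hIb : Integrable fun x => x 1 * radDerivQuot G x *
      fderiv ℝ (radDerivQuot G) x (EuclideanSpace.single 1 1) := by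
    have h := hq.integrable_mul hxq1
    exact h.congr (Eventually.of_forall fun x => by simp only [Pi.mul_apply]; ring)
  have hsq : Integrable fun x => radDerivQuot G x ^ 2 := hq.integrable_sq
  calc ∫ x, (fderiv ℝ (fun y => fderiv ℝ G y (EuclideanSpace.single 0 1)) x
          (EuclideanSpace.single 0 1) +
        fderiv ℝ (fun y => fderiv ℝ G y (EuclideanSpace.single 1 1)) x
          (EuclideanSpace.single 1 1)) *
          radDerivQuot G x
      = ∫ x, (2 * radDerivQuot G x ^ 2 + (x 0 * radDerivQuot G x *
          fderiv ℝ (radDerivQuot G) x (EuclideanSpace.single 0 1) + x 1 * radDerivQuot G x *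
          fderiv ℝ (radDerivQuot G) x (EuclideanSpace.single 1 1))) := by
        refine integral_congr_ae (Eventually.of_forall fun x => ?_)
        simp only
        rw [laplacianH_eq_two_mul_radDerivQuot_add hG hax x]
        ring
    _ = 2 * (∫ x, radDerivQuot G x ^ 2) + ((∫ x, x 0 * radDerivQuot G x *
          fderiv ℝ (radDerivQuot G) x (EuclideanSpace.single 0 1)) + ∫ x, x 1 * radDerivQuot G x *
          fderiv ℝ (radDerivQuot G) x (EuclideanSpace.single 1 1)) := by
        have hIab : Integrable fun x => x 0 * radDerivQuot G x *
            fderiv ℝ (radDerivQuot G) x (EuclideanSpace.single 0 1) + x 1 * radDerivQuot G x *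
            fderiv ℝ (radDerivQuot G) x (EuclideanSpace.single 1 1) := hIa.add hIb
        have h2 : Integrable fun x => 2 * radDerivQuot G x ^ 2 := hsq.const_mul 2
        rw [integral_add h2 hIab, integral_const_mul, integral_add hIa hIb]
    _ = ∫ x, radDerivQuot G x ^ 2 := by rw [h0, h1]; ring

/-- **`0 ≤ ∫ ∂₂∂₂G · q_G`** for an axisymmetric scalar `G ∈ C³` with
`q_G, ∂₂G, ∂₂∂₂G, q_{∂₂G} ∈ L²`: by parts in `e₂`, `∫ ∂₂∂₂G q = −∫ ∂₂G ∂₂q = −∫ H q_H ≥ 0` with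
`H = ∂₂G` (`fderiv_radDerivQuot_single_two` and the sign of the axis term). [folklore] -/
theorem integral_fderiv_fderiv_two_mul_radDerivQuot_nonneg (hG : ContDiff ℝ 3 G)
    (hax : IsAxisymmetricScalar G) (hq : MemLp (radDerivQuot G) 2 volume)
    (hH : MemLp (fun x => fderiv ℝ G x (EuclideanSpace.single 2 1)) 2 volume)
    (hHH : MemLp (fun x => fderiv ℝ (fun y => fderiv ℝ G y (EuclideanSpace.single 2 1)) x
      (EuclideanSpace.single 2 1)) 2 volume)
    (hqH : MemLp (radDerivQuot fun y => fderiv ℝ G y (EuclideanSpace.single 2 1)) 2 volume) :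
    0 ≤ ∫ x, fderiv ℝ (fun y => fderiv ℝ G y (EuclideanSpace.single 2 1)) x
      (EuclideanSpace.single 2 1) * radDerivQuot G x := by
  have hG2 : ContDiff ℝ 2 G := hG.of_le (by norm_num)
  have hGd : Differentiable ℝ G := hG.differentiable (by norm_num)
  have hq1 : ContDiff ℝ 1 (radDerivQuot G) := contDiff_radDerivQuot (n := 1) (by exact_mod_cast hG)
  have hqd : Differentiable ℝ (radDerivQuot G) := hq1.differentiable one_ne_zero
  set H : EuclideanSpace ℝ (Fin 3) → ℝ := fun y => fderiv ℝ G y (EuclideanSpace.single 2 1)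
    with hHdef
  have hH2 : ContDiff ℝ 2 H := contDiff_fderiv_apply_const_succ (n := 2) (by exact_mod_cast hG) _
  have hHd : Differentiable ℝ H := hH2.differentiable two_ne_zero
  have hHax : IsAxisymmetricScalar H := hax.fderiv_apply_single_two hGd
  -- `∂₂ q = q_H`
  have hdq : (fun x => fderiv ℝ (radDerivQuot G) x (EuclideanSpace.single 2 1)) = radDerivQuot H :=
    funext fun x => fderiv_radDerivQuot_single_two hG hax x
  have hdqL2 : MemLp (fun x => fderiv ℝ (radDerivQuot G) x (EuclideanSpace.single 2 1)) 2
      volume := by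
    rw [hdq]; exact hqH
  -- by parts: `∫ q ∂₂H = −∫ ∂₂q H`
  have hibp := integral_mul_fderiv_eq_neg_of_differentiable hqd hHd (EuclideanSpace.single 2 1)
    (hdqL2.integrable_mul hH) (hq.integrable_mul hHH) (hq.integrable_mul hH)
  have hsign := hHax.integral_mul_radDerivQuot_nonpos hH2 hH hqH
  have hdq' : ∀ x, fderiv ℝ (radDerivQuot G) x (EuclideanSpace.single 2 1) = radDerivQuot H x :=
    fun x => fderiv_radDerivQuot_single_two hG hax x
  calc (0 : ℝ) ≤ -∫ x, H x * radDerivQuot H x := by linarith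
    _ = -∫ x, fderiv ℝ (radDerivQuot G) x (EuclideanSpace.single 2 1) * H x := by
        congr 1
        exact integral_congr_ae (Eventually.of_forall fun x => by simp only [hdq']; ring)
    _ = ∫ x, radDerivQuot G x * fderiv ℝ H x (EuclideanSpace.single 2 1) := hibp.symm
    _ = ∫ x, fderiv ℝ (fun y => fderiv ℝ G y (EuclideanSpace.single 2 1)) x
          (EuclideanSpace.single 2 1) * radDerivQuot G x :=
        integral_congr_ae (Eventually.of_forall fun x => by simp only [hHdef]; ring)

/-- **`∫ (ΔG)² ≤ ∫ (ΔG + 2q_G)²`** (`= ∫ (Δ₅G̃)²`, the five-dimensional Laplacian of KNSS/Hou–Li)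
for an axisymmetric scalar `G ∈ C³` with the square-integrability hypotheses of the two previous
lemmas and `∂ᵢ∂ᵢG ∈ L²`: `∫[(ΔG+2q)² − (ΔG)²] = 4∫ΔG q + 4∫q² = 8∫q² + 4∫∂₂∂₂G q ≥ 0`. [folklore] -/
theorem integral_laplacian_sq_le (hG : ContDiff ℝ 3 G) (hax : IsAxisymmetricScalar G)
    (hq : MemLp (radDerivQuot G) 2 volume)
    (hG0 : MemLp (fun x => fderiv ℝ G x (EuclideanSpace.single 0 1)) 2 volume)
    (hG1 : MemLp (fun x => fderiv ℝ G x (EuclideanSpace.single 1 1)) 2 volume)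
    (hG2' : MemLp (fun x => fderiv ℝ G x (EuclideanSpace.single 2 1)) 2 volume)
    (hG00 : MemLp (fun x => fderiv ℝ (fun y => fderiv ℝ G y (EuclideanSpace.single 0 1)) x
      (EuclideanSpace.single 0 1)) 2 volume)
    (hG11 : MemLp (fun x => fderiv ℝ (fun y => fderiv ℝ G y (EuclideanSpace.single 1 1)) x
      (EuclideanSpace.single 1 1)) 2 volume)
    (hG22 : MemLp (fun x => fderiv ℝ (fun y => fderiv ℝ G y (EuclideanSpace.single 2 1)) x
      (EuclideanSpace.single 2 1)) 2 volume)
    (hxq0 : MemLp (fun x => x 0 * fderiv ℝ (radDerivQuot G) x (EuclideanSpace.single 0 1)) 2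
      volume)
    (hxq1 : MemLp (fun x => x 1 * fderiv ℝ (radDerivQuot G) x (EuclideanSpace.single 1 1)) 2
      volume)
    (hqH : MemLp (radDerivQuot fun y => fderiv ℝ G y (EuclideanSpace.single 2 1)) 2 volume) :
    ∫ x, (Δ G) x ^ 2 ≤ ∫ x, ((Δ G) x + 2 * radDerivQuot G x) ^ 2 := by
  have hG2 : ContDiff ℝ 2 G := hG.of_le (by norm_num)
  -- the Laplacian in coordinates
  have hLap : ∀ x, (Δ G) x =
      fderiv ℝ (fun y => fderiv ℝ G y (EuclideanSpace.single 0 1)) x (EuclideanSpace.single 0 1) +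
      fderiv ℝ (fun y => fderiv ℝ G y (EuclideanSpace.single 1 1)) x (EuclideanSpace.single 1 1) +
      fderiv ℝ (fun y => fderiv ℝ G y (EuclideanSpace.single 2 1)) x
        (EuclideanSpace.single 2 1) := by
    intro x
    rw [laplacian_eq_sum_fderiv_fderiv (EuclideanSpace.basisFun (Fin 3) ℝ) hG2 x]
    simp only [EuclideanSpace.basisFun_apply, Fin.sum_univ_three]
  have hLapL2 : MemLp (Δ G) 2 volume := by
    have h := (hG00.add hG11).add hG22
    refine h.ae_eq (Eventually.of_forall fun x => ?_)
    simp only [Pi.add_apply, hLap]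
  have hA := integral_laplacianH_mul_radDerivQuot hG hax hq hG0 hG1 hxq0 hxq1
  have hB := integral_fderiv_fderiv_two_mul_radDerivQuot_nonneg hG hax hq hG2' hG22 hqH
  -- integrability of the pieces
  have hI1 : Integrable fun x => (Δ G) x ^ 2 := hLapL2.integrable_sq
  have hI2 : Integrable fun x => (Δ G) x * radDerivQuot G x := hLapL2.integrable_mul hq
  have hI3 : Integrable fun x => radDerivQuot G x ^ 2 := hq.integrable_sq
  have hIh : Integrable fun x => (fderiv ℝ (fun y => fderiv ℝ G y (EuclideanSpace.single 0 1)) x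
      (EuclideanSpace.single 0 1) + fderiv ℝ (fun y => fderiv ℝ G y (EuclideanSpace.single 1 1)) x
      (EuclideanSpace.single 1 1)) * radDerivQuot G x := (hG00.add hG11).integrable_mul hq
  have hIz : Integrable fun x => fderiv ℝ (fun y => fderiv ℝ G y (EuclideanSpace.single 2 1)) x
      (EuclideanSpace.single 2 1) * radDerivQuot G x := hG22.integrable_mul hq
  -- `∫ ΔG q = ∫ q² + ∫ ∂₂∂₂G q`
  have hLq : ∫ x, (Δ G) x * radDerivQuot G x = (∫ x, radDerivQuot G x ^ 2) +
      ∫ x, fderiv ℝ (fun y => fderiv ℝ G y (EuclideanSpace.single 2 1)) x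
        (EuclideanSpace.single 2 1) * radDerivQuot G x := by
    rw [← hA, ← integral_add hIh hIz]
    refine integral_congr_ae (Eventually.of_forall fun x => ?_)
    simp only [hLap]
    ring
  -- expand the square
  have hI4 : Integrable fun x => 4 * ((Δ G) x * radDerivQuot G x) := hI2.const_mul 4
  have hI5 : Integrable fun x => 4 * radDerivQuot G x ^ 2 := hI3.const_mul 4
  have hI6 : Integrable fun x => (Δ G) x ^ 2 + 4 * ((Δ G) x * radDerivQuot G x) := hI1.add hI4
  have hexp : ∫ x, ((Δ G) x + 2 * radDerivQuot G x) ^ 2 =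
      (∫ x, (Δ G) x ^ 2) + 4 * (∫ x, (Δ G) x * radDerivQuot G x) +
        4 * ∫ x, radDerivQuot G x ^ 2 := by
    rw [← integral_const_mul, ← integral_const_mul, ← integral_add hI1 hI4, ← integral_add hI6 hI5]
    refine integral_congr_ae (Eventually.of_forall fun x => ?_)
    simp only
    ring
  have hpos : 0 ≤ ∫ x, radDerivQuot G x ^ 2 := integral_nonneg fun x => sq_nonneg _
  rw [hexp, hLq]
  nlinarith [hB, hpos]

end Integrated


/-! ### Lemma 2.1 for `ρ = u^r/r` -/

section Lemma21

variable {u : EuclideanSpace ℝ (Fin 3) → EuclideanSpace ℝ (Fin 3)}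

/-- **Lemma 2.1, second estimate (Laplacian form): `∫ (Δ(u^r/r))² ≤ ∫ (∂_z(ω^θ/r))²`** for an
axisymmetric divergence-free `u ∈ C⁵` whose quotients `ρ = u^r/r`, `ω₁ = ω^θ/r` satisfy the
square-integrability hypotheses listed (all hold for smooth finite-energy fields). Proof:
`Δρ + 2q_ρ = ∂_zω₁` (`laplacian_radVelQuot_add`) and `∫(Δρ)² ≤ ∫(Δρ + 2q_ρ)²`
(`integral_laplacian_sq_le`). Lei–Zhang state `‖∇²(v^r/r)‖_{L²} ≤ K₀‖∂_zΩ‖_{L²}`; the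
Laplacian form (which is what Agmon's inequality consumes) holds with `K₀ = 1`.
[cite: LeiZhang2017, Lemma 2.1 (second estimate)] -/
theorem IsAxisymmetric.integral_laplacian_radVelQuot_sq_le (hax : IsAxisymmetric u)
    (hu : ContDiff ℝ 5 u) (hdiv : VectorCalculus.IsDivFree u)
    (hq : MemLp (radDerivQuot (radVelQuot u)) 2 volume)
    (hG0 : MemLp (fun x => fderiv ℝ (radVelQuot u) x (EuclideanSpace.single 0 1)) 2 volume)
    (hG1 : MemLp (fun x => fderiv ℝ (radVelQuot u) x (EuclideanSpace.single 1 1)) 2 volume)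
    (hG2 : MemLp (fun x => fderiv ℝ (radVelQuot u) x (EuclideanSpace.single 2 1)) 2 volume)
    (hG00 : MemLp (fun x =>
      fderiv ℝ (fun y => fderiv ℝ (radVelQuot u) y (EuclideanSpace.single 0 1)) x
      (EuclideanSpace.single 0 1)) 2 volume)
    (hG11 : MemLp (fun x =>
      fderiv ℝ (fun y => fderiv ℝ (radVelQuot u) y (EuclideanSpace.single 1 1)) x
      (EuclideanSpace.single 1 1)) 2 volume)
    (hG22 : MemLp (fun x =>
      fderiv ℝ (fun y => fderiv ℝ (radVelQuot u) y (EuclideanSpace.single 2 1)) x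
      (EuclideanSpace.single 2 1)) 2 volume)
    (hxq0 : MemLp (fun x => x 0 * fderiv ℝ (radDerivQuot (radVelQuot u)) x
      (EuclideanSpace.single 0 1)) 2 volume)
    (hxq1 : MemLp (fun x => x 1 * fderiv ℝ (radDerivQuot (radVelQuot u)) x
      (EuclideanSpace.single 1 1)) 2 volume)
    (hqH : MemLp (radDerivQuot fun y => fderiv ℝ (radVelQuot u) y (EuclideanSpace.single 2 1)) 2
      volume) :
    ∫ x, (Δ (radVelQuot u)) x ^ 2 ≤
      ∫ x, fderiv ℝ (angVortQuot u) x (EuclideanSpace.single 2 1) ^ 2 := by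
  have hu4 : ContDiff ℝ 4 u := hu.of_le (by norm_num)
  have hρ3 : ContDiff ℝ 3 (radVelQuot u) := contDiff_radVelQuot (n := 3) (by exact_mod_cast hu)
  have hρax : IsAxisymmetricScalar (radVelQuot u) :=
    hax.isAxisymmetricScalar_radVelQuot (hu.of_le (by norm_num))
  have h := integral_laplacian_sq_le hρ3 hρax hq hG0 hG1 hG2 hG00 hG11 hG22 hxq0 hxq1 hqH
  refine h.trans_eq (integral_congr_ae (Eventually.of_forall fun x => ?_))
  simp only
  rw [hax.laplacian_radVelQuot_add hu4 hdiv x]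

/-- **Lemma 2.1, first estimate: `∫ |∇(u^r/r)|² ≤ ∫ (ω^θ/r)²`** (`K₀ = 1`) for an axisymmetric
divergence-free `u ∈ C⁴` whose quotients `ρ = u^r/r`, `ω₁ = ω^θ/r` satisfy the listed
square-integrability hypotheses. Proof: pair `Δρ + 2q_ρ = ∂_zω₁` with `ρ`:
`−∫|∇ρ|² + 2∫ρq_ρ = −∫ω₁∂₂ρ` (by parts), `∫ρq_ρ ≤ 0` (axis term), and
`∫ω₁∂₂ρ ≤ ½∫ω₁² + ½∫(∂₂ρ)²`. [cite: LeiZhang2017, Lemma 2.1 (first estimate)] -/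
theorem IsAxisymmetric.integral_gradSq_radVelQuot_le (hax : IsAxisymmetric u)
    (hu : ContDiff ℝ 4 u) (hdiv : VectorCalculus.IsDivFree u)
    (hρ : MemLp (radVelQuot u) 2 volume) (hq : MemLp (radDerivQuot (radVelQuot u)) 2 volume)
    (hG0 : MemLp (fun x => fderiv ℝ (radVelQuot u) x (EuclideanSpace.single 0 1)) 2 volume)
    (hG1 : MemLp (fun x => fderiv ℝ (radVelQuot u) x (EuclideanSpace.single 1 1)) 2 volume)
    (hG2 : MemLp (fun x => fderiv ℝ (radVelQuot u) x (EuclideanSpace.single 2 1)) 2 volume)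
    (hG00 : MemLp (fun x =>
      fderiv ℝ (fun y => fderiv ℝ (radVelQuot u) y (EuclideanSpace.single 0 1)) x
      (EuclideanSpace.single 0 1)) 2 volume)
    (hG11 : MemLp (fun x =>
      fderiv ℝ (fun y => fderiv ℝ (radVelQuot u) y (EuclideanSpace.single 1 1)) x
      (EuclideanSpace.single 1 1)) 2 volume)
    (hG22 : MemLp (fun x =>
      fderiv ℝ (fun y => fderiv ℝ (radVelQuot u) y (EuclideanSpace.single 2 1)) x
      (EuclideanSpace.single 2 1)) 2 volume)
    (hω : MemLp (angVortQuot u) 2 volume)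
    (hωz : MemLp (fun x => fderiv ℝ (angVortQuot u) x (EuclideanSpace.single 2 1)) 2 volume) :
    ∫ x, (fderiv ℝ (radVelQuot u) x (EuclideanSpace.single 0 1) ^ 2 +
        fderiv ℝ (radVelQuot u) x (EuclideanSpace.single 1 1) ^ 2 +
        fderiv ℝ (radVelQuot u) x (EuclideanSpace.single 2 1) ^ 2) ≤
      ∫ x, angVortQuot u x ^ 2 := by
  -- notation-free abbreviations
  have hu2 : ContDiff ℝ 2 u := hu.of_le (by norm_num)
  have hρ2 : ContDiff ℝ 2 (radVelQuot u) := contDiff_radVelQuot (n := 2) (by exact_mod_cast hu)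
  have hρd : Differentiable ℝ (radVelQuot u) := hρ2.differentiable two_ne_zero
  have hρax : IsAxisymmetricScalar (radVelQuot u) := hax.isAxisymmetricScalar_radVelQuot hu2
  have hω1 : ContDiff ℝ 1 (angVortQuot u) := contDiff_angVortQuot (n := 1) (by exact_mod_cast hu)
  have hωd : Differentiable ℝ (angVortQuot u) := hω1.differentiable one_ne_zero
  -- (i) `∫ ρ ∂ᵢ∂ᵢρ = −∫ (∂ᵢρ)²`
  have hI0 := integral_mul_fderiv_fderiv_eq_neg_sq hρ2 (EuclideanSpace.single 0 1) hρ hG0 hG00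
  have hI1 := integral_mul_fderiv_fderiv_eq_neg_sq hρ2 (EuclideanSpace.single 1 1) hρ hG1 hG11
  have hI2 := integral_mul_fderiv_fderiv_eq_neg_sq hρ2 (EuclideanSpace.single 2 1) hρ hG2 hG22
  -- (ii) the axis term
  have hax' := hρax.integral_mul_radDerivQuot_nonpos hρ2 hρ hq
  -- (iii) `∫ ρ ∂₂ω₁ = −∫ ∂₂ρ ω₁`
  have hibp := integral_mul_fderiv_eq_neg_of_differentiable hρd hωd (EuclideanSpace.single 2 1)
    (hG2.integrable_mul hω) (hρ.integrable_mul hωz) (hρ.integrable_mul hω)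
  -- integrate the identity against `ρ`
  have hid : ∀ x, radVelQuot u x *
      (fderiv ℝ (fun y => fderiv ℝ (radVelQuot u) y (EuclideanSpace.single 0 1)) x
          (EuclideanSpace.single 0 1) +
        fderiv ℝ (fun y => fderiv ℝ (radVelQuot u) y (EuclideanSpace.single 1 1)) x
          (EuclideanSpace.single 1 1) +
        fderiv ℝ (fun y => fderiv ℝ (radVelQuot u) y (EuclideanSpace.single 2 1)) x
          (EuclideanSpace.single 2 1)) + 2 * (radVelQuot u x * radDerivQuot (radVelQuot u) x) =
      radVelQuot u x * fderiv ℝ (angVortQuot u) x (EuclideanSpace.single 2 1) := by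
    intro x
    have h := hax.laplacian_radVelQuot_add hu hdiv x
    rw [laplacian_eq_sum_fderiv_fderiv (EuclideanSpace.basisFun (Fin 3) ℝ) hρ2 x] at h
    simp only [EuclideanSpace.basisFun_apply, Fin.sum_univ_three] at h
    rw [← h]
    ring
  -- integrability of the pieces
  have hJ0 : Integrable fun x => radVelQuot u x *
      fderiv ℝ (fun y => fderiv ℝ (radVelQuot u) y (EuclideanSpace.single 0 1)) x
        (EuclideanSpace.single 0 1) := hρ.integrable_mul hG00
  have hJ1 : Integrable fun x => radVelQuot u x *
      fderiv ℝ (fun y => fderiv ℝ (radVelQuot u) y (EuclideanSpace.single 1 1)) x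
        (EuclideanSpace.single 1 1) := hρ.integrable_mul hG11
  have hJ2 : Integrable fun x => radVelQuot u x *
      fderiv ℝ (fun y => fderiv ℝ (radVelQuot u) y (EuclideanSpace.single 2 1)) x
        (EuclideanSpace.single 2 1) := hρ.integrable_mul hG22
  have hJq : Integrable fun x => radVelQuot u x * radDerivQuot (radVelQuot u) x :=
    hρ.integrable_mul hq
  have hJ01 : Integrable fun x => radVelQuot u x *
      fderiv ℝ (fun y => fderiv ℝ (radVelQuot u) y (EuclideanSpace.single 0 1)) x
        (EuclideanSpace.single 0 1) + radVelQuot u x *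
      fderiv ℝ (fun y => fderiv ℝ (radVelQuot u) y (EuclideanSpace.single 1 1)) x
        (EuclideanSpace.single 1 1) := hJ0.add hJ1
  have hJ012 : Integrable fun x => radVelQuot u x *
      fderiv ℝ (fun y => fderiv ℝ (radVelQuot u) y (EuclideanSpace.single 0 1)) x
        (EuclideanSpace.single 0 1) + radVelQuot u x *
      fderiv ℝ (fun y => fderiv ℝ (radVelQuot u) y (EuclideanSpace.single 1 1)) x
        (EuclideanSpace.single 1 1) + radVelQuot u x *
      fderiv ℝ (fun y => fderiv ℝ (radVelQuot u) y (EuclideanSpace.single 2 1)) x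
        (EuclideanSpace.single 2 1) := hJ01.add hJ2
  have hJ2q : Integrable fun x => 2 * (radVelQuot u x * radDerivQuot (radVelQuot u) x) :=
    hJq.const_mul 2
  -- `∫ (identity · ρ)`
  have hsum : ((∫ x, radVelQuot u x *
      fderiv ℝ (fun y => fderiv ℝ (radVelQuot u) y (EuclideanSpace.single 0 1)) x
        (EuclideanSpace.single 0 1)) + (∫ x, radVelQuot u x *
      fderiv ℝ (fun y => fderiv ℝ (radVelQuot u) y (EuclideanSpace.single 1 1)) x
        (EuclideanSpace.single 1 1)) + (∫ x, radVelQuot u x *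
      fderiv ℝ (fun y => fderiv ℝ (radVelQuot u) y (EuclideanSpace.single 2 1)) x
        (EuclideanSpace.single 2 1))) + 2 * (∫ x, radVelQuot u x * radDerivQuot (radVelQuot u) x) =
      ∫ x, radVelQuot u x * fderiv ℝ (angVortQuot u) x (EuclideanSpace.single 2 1) := by
    rw [← integral_add hJ0 hJ1, ← integral_add hJ01 hJ2, ← integral_const_mul,
      ← integral_add hJ012 hJ2q]
    refine integral_congr_ae (Eventually.of_forall fun x => ?_)
    beta_reduce
    rw [← hid x]
    ring
  rw [hI0, hI1, hI2, hibp] at hsum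
  -- Young: `∫ ∂₂ρ ω₁ ≤ ½∫ω₁² + ½∫(∂₂ρ)²`
  have hY : ∫ x, fderiv ℝ (radVelQuot u) x (EuclideanSpace.single 2 1) * angVortQuot u x ≤
      (1 / 2) * (∫ x, angVortQuot u x ^ 2) +
        (1 / 2) * ∫ x, fderiv ℝ (radVelQuot u) x (EuclideanSpace.single 2 1) ^ 2 := by
    have hIa : Integrable fun x => 1 / 2 * angVortQuot u x ^ 2 := hω.integrable_sq.const_mul _
    have hIb : Integrable fun x =>
        1 / 2 * fderiv ℝ (radVelQuot u) x (EuclideanSpace.single 2 1) ^ 2 :=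
      hG2.integrable_sq.const_mul _
    rw [← integral_const_mul, ← integral_const_mul, ← integral_add hIa hIb]
    refine integral_mono (hG2.integrable_mul hω) (hIa.add hIb) fun x => ?_
    beta_reduce
    nlinarith [sq_nonneg (fderiv ℝ (radVelQuot u) x (EuclideanSpace.single 2 1) - angVortQuot u x)]
  -- the three squares
  have hS : ∫ x, (fderiv ℝ (radVelQuot u) x (EuclideanSpace.single 0 1) ^ 2 +
        fderiv ℝ (radVelQuot u) x (EuclideanSpace.single 1 1) ^ 2 +
        fderiv ℝ (radVelQuot u) x (EuclideanSpace.single 2 1) ^ 2) =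
      (∫ x, fderiv ℝ (radVelQuot u) x (EuclideanSpace.single 0 1) ^ 2) +
        (∫ x, fderiv ℝ (radVelQuot u) x (EuclideanSpace.single 1 1) ^ 2) +
        ∫ x, fderiv ℝ (radVelQuot u) x (EuclideanSpace.single 2 1) ^ 2 := by
    have h01 : Integrable fun x => fderiv ℝ (radVelQuot u) x (EuclideanSpace.single 0 1) ^ 2 +
        fderiv ℝ (radVelQuot u) x (EuclideanSpace.single 1 1) ^ 2 :=
      hG0.integrable_sq.add hG1.integrable_sq
    rw [integral_add h01 hG2.integrable_sq, integral_add hG0.integrable_sq hG1.integrable_sq]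
  have hnn0 : 0 ≤ ∫ x, fderiv ℝ (radVelQuot u) x (EuclideanSpace.single 0 1) ^ 2 :=
    integral_nonneg fun x => sq_nonneg _
  have hnn1 : 0 ≤ ∫ x, fderiv ℝ (radVelQuot u) x (EuclideanSpace.single 1 1) ^ 2 :=
    integral_nonneg fun x => sq_nonneg _
  rw [hS]
  linarith [hsum, hY, hax', hnn0, hnn1]

end Lemma21

end Literature.Analysis.FluidPDE

end
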